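import Mathlib
import Summits.ValiantsHypothesis.ValiantsHypothesis.Theorems.BarrierLeverDefinableEquationsLinearSizeLeafCount
import HarnessLib

/-!
# Linear-size circuits III: slot counting on the useful sub-DAG; a variable of degree ≤ 2

Route `BarrierLever`, crux `DefinableEquations` (stmt-ValiantsHypothesis-8745), line `registered`,
lead c3.  The STRUCTURE THEOREM behind the first rung (`b ≤ 1`) of the crux, registered sub-goal
`exists_degreeOf_le_two_of_complexity_le`: a polynomial of fan-in-two complexity `≤ n` in `n ≥ 1`
variables has a variable of individual degree `≤ 2`; with excess, `L(f) ≤ n + t` gives a variable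
of degree `≤ 2^(t+1)` (so `L(f) > n + t` once all individual degrees exceed `2^(t+1)`), and if
every variable has positive degree then EVERY variable obeys the bound (read-once plus `t + 1`
defects).  With `rungOne_of_exists_degreeOf_le_two` (landed) the case `t = 0` yields the crux's
inner statement for every `b ≤ 1` with `(q, a) = (0, 1)` (the monomial `∏_j c_{x_j^3}`).
Proof (uniform slot counting): `degreeOf x f ≤ Lf gs x o` (file II); fan-in two gives
`Σ_x occ x + Σ_{j ∈ A ∖ o} ref j ≤ 2 #A ≤ #A + n + t` (`A` = useful gates, `#A ≤ n + t`); a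
variable with `occ = 0` has degree `0`, otherwise `occ, ref ≥ 1` and the total excess is `≤ t + 1`;
`N gs o j ≤ Π ref` (downward induction on the parent identity), so
`Lf ≤ (Π ref) · occ ≤ 2^{excess} ≤ 2^(t+1)`.
-/

set_option linter.dupNamespace false

noncomputable section

namespace Summit.ValiantsHypothesis.ValiantsHypothesis.Theorems.BarrierLeverDefinableEquations

namespace LinearSize

open Literature.Computability.AlgebraicComplexity ArithCircuit MvPolynomial
open scoped BigOperators

/-! ## Slot counting on the useful sub-DAG -/

section Useful

variable {k : Type} {σ : Type}

/-- A gate referenced by a useful gate is useful. [folklore] -/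
theorem mem_useful_of_refCnt_ne_zero {gs : List (Gate k σ)} {o i j : ℕ} (hi : i ∈ useful gs o)
    (hji : j < i) (h : refCnt (gateAt gs i) j ≠ 0) : j ∈ useful gs o := by
  obtain ⟨hio, hN⟩ := mem_useful.1 hi
  refine mem_useful.2 ⟨by omega, fun h0 => ?_⟩
  have hjo : j < o := lt_of_lt_of_le hji hio
  rw [N_eq_sum_parent gs hjo] at h0
  exact mul_ne_zero hN h (Finset.sum_eq_zero_iff.1 h0 i (Finset.mem_Ioc.2 ⟨hji, hio⟩))

/-- Every useful gate other than the output is referenced: `1 ≤ ref`. [folklore] -/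
theorem one_le_ref {gs : List (Gate k σ)} {o j : ℕ} (hj : j ∈ useful gs o) (hjo : j ≠ o) :
    1 ≤ ref gs o j := by
  obtain ⟨hjo', hN⟩ := mem_useful.1 hj
  have hlt : j < o := lt_of_le_of_ne hjo' hjo
  rw [N_eq_sum_parent gs hlt] at hN
  obtain ⟨i, hi, hne⟩ := Finset.exists_ne_zero_of_sum_ne_zero hN
  rw [Finset.mem_Ioc] at hi
  have hNi : N gs o i ≠ 0 := fun h => hne (by rw [h, zero_mul])
  have hri : refCnt (gateAt gs i) j ≠ 0 := fun h => hne (by rw [h, mul_zero])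
  have hiu : i ∈ (useful gs o).filter (fun i => j < i) :=
    Finset.mem_filter.2 ⟨mem_useful.2 ⟨hi.2, hNi⟩, hi.1⟩
  calc 1 ≤ refCnt (gateAt gs i) j := Nat.pos_of_ne_zero hri
    _ ≤ ref gs o j := Finset.single_le_sum (f := fun i => refCnt (gateAt gs i) j)
        (fun _ _ => Nat.zero_le _) hiu

/-- **Path counts are bounded by products of reference multiplicities**:
`N gs o j ≤ Π_{j' useful, j ≤ j' < o} ref gs o j'`. [folklore] -/
theorem N_le_prod_ref (gs : List (Gate k σ)) (o j : ℕ) :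
    N gs o j ≤ ∏ j' ∈ (useful gs o).filter (fun j' => j ≤ j' ∧ j' < o), ref gs o j' := by
  -- strong downward induction on `o - j`
  suffices H : ∀ d j, o = j + d →
      N gs o j ≤ ∏ j' ∈ (useful gs o).filter (fun j' => j ≤ j' ∧ j' < o), ref gs o j' by
    rcases Nat.lt_or_ge o j with h | h
    · rw [N_eq_zero_of_lt gs h]; exact Nat.zero_le _
    · exact H (o - j) j (by omega)
  intro d
  induction d using Nat.strong_induction_on with
  | _ d ih =>
    intro j hd
    rcases Nat.eq_zero_or_pos d with rfl | hdpos
    · rw [add_zero] at hd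
      subst hd
      rw [N_self]
      have hempty : (useful gs o).filter (fun j' => o ≤ j' ∧ j' < o) = ∅ :=
        Finset.filter_eq_empty_iff.2 fun j' _ h => by omega
      rw [hempty, Finset.prod_empty]
    have hjo : j < o := by omega
    by_cases hju : j ∈ useful gs o
    swap
    · rw [N_eq_zero_of_not_mem_useful hju]; exact Nat.zero_le _
    set R' := ∏ j' ∈ (useful gs o).filter (fun j' => j < j' ∧ j' < o), ref gs o j' with hR'
    have hfac : ∏ j' ∈ (useful gs o).filter (fun j' => j ≤ j' ∧ j' < o), ref gs o j'
        = ref gs o j * R' := by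
      have hset : (useful gs o).filter (fun j' => j ≤ j' ∧ j' < o)
          = insert j ((useful gs o).filter (fun j' => j < j' ∧ j' < o)) := by
        ext j'
        simp only [Finset.mem_filter, Finset.mem_insert]
        constructor
        · rintro ⟨hu, h1, h2⟩
          rcases Nat.eq_or_lt_of_le h1 with h1' | h1'
          · exact Or.inl h1'.symm
          · exact Or.inr ⟨hu, h1', h2⟩
        · rintro (rfl | ⟨hu, h1, h2⟩)
          · exact ⟨hju, le_rfl, hjo⟩
          · exact ⟨hu, h1.le, h2⟩
      rw [hset, Finset.prod_insert (by simp)]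
    rw [hfac, N_eq_sum_parent gs hjo]
    -- bound each term through the induction hypothesis
    have hterm : ∀ i' ∈ Finset.Ioc j o, N gs o i' * refCnt (gateAt gs i') j ≤
        R' * (if i' ∈ useful gs o then refCnt (gateAt gs i') j else 0) := by
      intro i' hi'
      rw [Finset.mem_Ioc] at hi'
      by_cases hiu : i' ∈ useful gs o
      swap
      · rw [N_eq_zero_of_not_mem_useful hiu, zero_mul]; exact Nat.zero_le _
      rw [if_pos hiu]
      refine Nat.mul_le_mul_right _ ((ih (o - i') (by omega) i' (by omega)).trans ?_)
      refine Finset.prod_le_prod_of_subset_of_one_le' (fun j' hj' => ?_) (fun j' hj' _ => ?_)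
      · simp only [Finset.mem_filter] at hj' ⊢
        exact ⟨hj'.1, by omega, hj'.2.2⟩
      · simp only [Finset.mem_filter] at hj'
        exact one_le_ref hj'.1 (by omega)
    have hsum : ∑ i' ∈ Finset.Ioc j o, (if i' ∈ useful gs o then refCnt (gateAt gs i') j else 0)
        = ref gs o j := by
      rw [ref, ← Finset.sum_filter]
      refine Finset.sum_congr ?_ fun _ _ => rfl
      ext i'
      simp only [Finset.mem_filter, Finset.mem_Ioc, mem_useful]
      constructor
      · rintro ⟨⟨h1, _⟩, h3⟩; exact ⟨h3, h1⟩
      · rintro ⟨h3, h1⟩; exact ⟨⟨h1, h3.1⟩, h3⟩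
    calc ∑ i' ∈ Finset.Ioc j o, N gs o i' * refCnt (gateAt gs i') j
        ≤ ∑ i' ∈ Finset.Ioc j o,
            R' * (if i' ∈ useful gs o then refCnt (gateAt gs i') j else 0) :=
          Finset.sum_le_sum hterm
      _ = R' * ref gs o j := by rw [← Finset.mul_sum, hsum]
      _ = ref gs o j * R' := mul_comm _ _

variable [DecidableEq σ]

/-- A variable that occurs in no useful gate labels no leaf. [folklore] -/
theorem Lf_eq_zero_of_occ_eq_zero {gs : List (Gate k σ)} {o : ℕ} {x : σ} (h : occ gs o x = 0) :
    Lf gs x o = 0 := by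
  rw [Lf_eq_sum_N]
  refine Finset.sum_eq_zero fun j _ => ?_
  by_cases hju : j ∈ useful gs o
  · rw [show varCnt (gateAt gs j) x = 0 from Finset.sum_eq_zero_iff.1 h j hju, mul_zero]
  · rw [N_eq_zero_of_not_mem_useful hju, zero_mul]

/-- **Leaves ≤ (Π ref) · occ.** [folklore] -/
theorem Lf_le_prod_ref_mul_occ (gs : List (Gate k σ)) (o : ℕ) (x : σ) :
    Lf gs x o ≤ (∏ j' ∈ (useful gs o).erase o, ref gs o j') * occ gs o x := by
  rw [Lf_eq_sum_N, occ, Finset.mul_sum]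
  have hsub : useful gs o ⊆ Finset.range (o + 1) := Finset.filter_subset _ _
  rw [← Finset.sum_subset hsub (fun j _ hj => by rw [N_eq_zero_of_not_mem_useful hj, zero_mul])]
  refine Finset.sum_le_sum fun j _ => Nat.mul_le_mul_right _ ((N_le_prod_ref gs o j).trans ?_)
  refine Finset.prod_le_prod_of_subset_of_one_le' (fun j' hj' => ?_) (fun j' hj' _ => ?_)
  · simp only [Finset.mem_filter] at hj'
    exact Finset.mem_erase.2 ⟨by omega, hj'.1⟩
  · rw [Finset.mem_erase] at hj'
    exact one_le_ref hj'.2 hj'.1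

/-- **Slot inequality**: `Σ_x occ x + Σ_{j useful, j ≠ o} ref j ≤ Σ_{i useful} fanIn (gs i)`.
[folklore] -/
theorem sum_occ_add_sum_ref_le [Fintype σ] (gs : List (Gate k σ)) (o : ℕ) :
    ∑ x, occ gs o x + ∑ j ∈ (useful gs o).erase o, ref gs o j ≤
      ∑ i ∈ useful gs o, (gateAt gs i).fanIn := by
  have h1 : ∑ x, occ gs o x = ∑ i ∈ useful gs o, ∑ x, varCnt (gateAt gs i) x := by
    simp only [occ]
    rw [Finset.sum_comm]
  have hswap : ∑ i ∈ useful gs o, ∑ j ∈ Finset.range i, refCnt (gateAt gs i) j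
      = ∑ j ∈ Finset.range o, ref gs o j := by
    simp only [ref]
    refine Finset.sum_comm' fun i j => ?_
    simp only [Finset.mem_range, Finset.mem_filter, mem_useful]
    constructor
    · rintro ⟨⟨hio, hN⟩, hji⟩; exact ⟨⟨⟨hio, hN⟩, hji⟩, by omega⟩
    · rintro ⟨⟨⟨hio, hN⟩, hji⟩, _⟩; exact ⟨⟨hio, hN⟩, hji⟩
  have h2 : ∑ j ∈ (useful gs o).erase o, ref gs o j ≤
      ∑ i ∈ useful gs o, ∑ j ∈ Finset.range i, refCnt (gateAt gs i) j := by
    rw [hswap]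
    refine Finset.sum_le_sum_of_subset_of_nonneg (fun j hj => ?_) (fun _ _ _ => Nat.zero_le _)
    rw [Finset.mem_erase] at hj
    exact Finset.mem_range.2 (lt_of_le_of_ne (mem_useful.1 hj.2).1 hj.1)
  calc ∑ x, occ gs o x + ∑ j ∈ (useful gs o).erase o, ref gs o j
      ≤ ∑ i ∈ useful gs o, ∑ x, varCnt (gateAt gs i) x +
          ∑ i ∈ useful gs o, ∑ j ∈ Finset.range i, refCnt (gateAt gs i) j := by
        rw [h1]; exact Nat.add_le_add_left h2 _
    _ = ∑ i ∈ useful gs o, (∑ x, varCnt (gateAt gs i) x +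
          ∑ j ∈ Finset.range i, refCnt (gateAt gs i) j) := by
        rw [← Finset.sum_add_distrib]
    _ ≤ ∑ i ∈ useful gs o, (gateAt gs i).fanIn :=
        Finset.sum_le_sum fun i _ => sum_varCnt_add_sum_refCnt_le _ _

/-- **Leaf counts of economical circuits.** If the useful gates of the output `o` have fan-in
two, exceed the number of variables by at most `t`, and every variable occurs in a useful gate,
then every variable labels at most `2^(t+1)` leaves of the unfolding of `o`. [folklore] -/
theorem Lf_le_two_pow_succ [Fintype σ] (gs : List (Gate k σ)) (o t : ℕ)
    (hfan : ∀ i ∈ useful gs o, (gateAt gs i).fanIn ≤ 2)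
    (hcard : (useful gs o).card ≤ Fintype.card σ + t) (hocc : ∀ x, 1 ≤ occ gs o x) (x : σ) :
    Lf gs x o ≤ 2 ^ (t + 1) := by
  have hoU : o ∈ useful gs o := self_mem_useful gs o
  have hcardU : (useful gs o).card = ((useful gs o).erase o).card + 1 :=
    (Finset.card_erase_add_one hoU).symm
  have hslots := sum_occ_add_sum_ref_le gs o
  have hfan' : ∑ i ∈ useful gs o, (gateAt gs i).fanIn ≤ 2 * (useful gs o).card := by
    calc ∑ i ∈ useful gs o, (gateAt gs i).fanIn ≤ ∑ i ∈ useful gs o, 2 := Finset.sum_le_sum hfan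
      _ = 2 * (useful gs o).card := by rw [Finset.sum_const, smul_eq_mul, mul_comm]
  have hocc_sum : occ gs o x + (Finset.univ.erase x).card ≤ ∑ y, occ gs o y := by
    rw [← Finset.add_sum_erase _ _ (Finset.mem_univ x)]
    refine Nat.add_le_add_left ?_ _
    calc (Finset.univ.erase x).card = ∑ _y ∈ Finset.univ.erase x, 1 := by simp
      _ ≤ ∑ y ∈ Finset.univ.erase x, occ gs o y := Finset.sum_le_sum fun y _ => hocc y
  have hcardσ : Fintype.card σ = (Finset.univ.erase x).card + 1 := by
    rw [Finset.card_erase_of_mem (Finset.mem_univ x), Finset.card_univ]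
    have := Fintype.card_pos_iff.2 ⟨x⟩
    omega
  have href : ∀ j ∈ (useful gs o).erase o, 1 ≤ ref gs o j := fun j hj => by
    rw [Finset.mem_erase] at hj
    exact one_le_ref hj.2 hj.1
  -- the total excess of the multiplicities over 1 is at most t + 1
  have hexc : occ gs o x + ∑ j ∈ (useful gs o).erase o, ref gs o j ≤
      ((useful gs o).erase o).card + 2 + t := by
    omega
  have hprod := prod_mul_two_pow_card_le ((useful gs o).erase o) (ref gs o) href
  have hx : occ gs o x * 2 ≤ 2 ^ occ gs o x := mul_two_le_two_pow (hocc x)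
  have key : (∏ j ∈ (useful gs o).erase o, ref gs o j) * occ gs o x *
      2 ^ (((useful gs o).erase o).card + 1) ≤
        2 ^ (t + 1) * 2 ^ (((useful gs o).erase o).card + 1) := by
    calc (∏ j ∈ (useful gs o).erase o, ref gs o j) * occ gs o x *
          2 ^ (((useful gs o).erase o).card + 1)
        = ((∏ j ∈ (useful gs o).erase o, ref gs o j) * 2 ^ ((useful gs o).erase o).card) *
            (occ gs o x * 2) := by ring
      _ ≤ 2 ^ (∑ j ∈ (useful gs o).erase o, ref gs o j) * 2 ^ occ gs o x :=
          Nat.mul_le_mul hprod hx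
      _ = 2 ^ (∑ j ∈ (useful gs o).erase o, ref gs o j + occ gs o x) := by rw [← pow_add]
      _ ≤ 2 ^ (((useful gs o).erase o).card + 2 + t) :=
          Nat.pow_le_pow_right (by norm_num) (by omega)
      _ = 2 ^ (t + 1) * 2 ^ (((useful gs o).erase o).card + 1) := by ring
  have hle : (∏ j ∈ (useful gs o).erase o, ref gs o j) * occ gs o x ≤ 2 ^ (t + 1) :=
    Nat.le_of_mul_le_mul_right key (by positivity)
  exact (Lf_le_prod_ref_mul_occ gs o x).trans hle

/-- **Leaf counts of economical circuits are at most two** (the case `t = 0`: no more useful gates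
than variables). [folklore] -/
theorem Lf_le_two [Fintype σ] (gs : List (Gate k σ)) (o : ℕ)
    (hfan : ∀ i ∈ useful gs o, (gateAt gs i).fanIn ≤ 2)
    (hcard : (useful gs o).card ≤ Fintype.card σ) (hocc : ∀ x, 1 ≤ occ gs o x) (x : σ) :
    Lf gs x o ≤ 2 := by
  simpa using Lf_le_two_pow_succ gs o 0 hfan (by simpa using hcard) hocc x

end Useful

/-! ## The structure theorems -/

section Main

variable {k : Type} [CommSemiring k]

/-- The gate case with every variable occurring: all individual degrees are `≤ 2^(t+1)` when the
gate list exceeds the number of variables by at most `t`. [folklore] -/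
theorem degreeOf_getD_le_two_pow_of_forall_occ {n : ℕ} (gs : List (Gate k (Fin n))) (t : ℕ)
    (h2 : ∀ g ∈ gs, g.fanIn ≤ 2) {o : ℕ} (ho : o < gs.length) (hlen : gs.length ≤ n + t)
    (hocc : ∀ x, 1 ≤ occ gs o x) (x : Fin n) :
    ((gateValues gs).getD o 0).degreeOf x ≤ 2 ^ (t + 1) := by
  refine (degreeOf_gateValues_getD_le x gs o ho).trans (Lf_le_two_pow_succ gs o t ?_ ?_ hocc x)
  · intro i hi
    exact h2 _ (gateAt_mem gs (lt_of_le_of_lt (mem_useful.1 hi).1 ho))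
  · calc (useful gs o).card ≤ (Finset.range (o + 1)).card :=
          Finset.card_le_card (Finset.filter_subset _ _)
      _ = o + 1 := Finset.card_range _
      _ ≤ n + t := by omega
      _ = Fintype.card (Fin n) + t := by rw [Fintype.card_fin]

/-- **Structure theorem (circuit form, with excess `t`).** A fan-in-two circuit with at most
`n + t` gates over the `n ≥ 1` variables `x₀, …, x_{n-1}` computes a polynomial with a variable of
individual degree `≤ 2^(t+1)`. [folklore] -/
theorem exists_degreeOf_le_two_pow_of_size_le {n : ℕ} (hn : 1 ≤ n) (P : ArithCircuit k (Fin n))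
    (t : ℕ) (h2 : P.IsFanInTwo) (hs : P.size ≤ n + t) :
    ∃ j : Fin n, P.eval.degreeOf j ≤ 2 ^ (t + 1) := by
  have j0 : Fin n := ⟨0, hn⟩
  have h12 : 1 ≤ 2 ^ (t + 1) := Nat.one_le_two_pow
  unfold ArithCircuit.eval
  cases P.output with
  | var y =>
    refine ⟨j0, (degreeOf_X_le' j0 y).trans ?_⟩
    split_ifs <;> omega
  | const c => exact ⟨j0, by simp [Operand.eval, degreeOf_C]⟩
  | gate o =>
    simp only [Operand.eval]
    by_cases ho : o < P.gates.length
    swap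
    · refine ⟨j0, ?_⟩
      rw [List.getD_eq_getElem?_getD, List.getElem?_eq_none
        (by rw [gateValues_length]; exact Nat.le_of_not_lt ho)]
      simp
    by_cases hocc : ∀ x, 1 ≤ occ P.gates o x
    · exact ⟨j0, degreeOf_getD_le_two_pow_of_forall_occ P.gates t h2 ho hs hocc j0⟩
    · push Not at hocc
      obtain ⟨x, hx⟩ := hocc
      refine ⟨x, (degreeOf_gateValues_getD_le x P.gates o ho).trans ?_⟩
      rw [Lf_eq_zero_of_occ_eq_zero (Nat.lt_one_iff.1 hx)]
      exact Nat.zero_le _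

/-- **Structure theorem (circuit form).** A fan-in-two circuit with at most `n` gates over the
`n ≥ 1` variables `x₀, …, x_{n-1}` computes a polynomial with a variable of individual degree
`≤ 2`. [folklore] -/
theorem exists_degreeOf_le_two_of_size_le {n : ℕ} (hn : 1 ≤ n) (P : ArithCircuit k (Fin n))
    (h2 : P.IsFanInTwo) (hs : P.size ≤ n) : ∃ j : Fin n, P.eval.degreeOf j ≤ 2 := by
  simpa using exists_degreeOf_le_two_pow_of_size_le hn P 0 h2 (by simpa using hs)

/-- **Structure theorem (all variables present, with excess `t`).** If every variable has
positive degree in the polynomial computed by a fan-in-two circuit with at most `n + t` gates,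
then EVERY variable has individual degree `≤ 2^(t+1)`. [folklore] -/
theorem degreeOf_le_two_pow_of_size_le_of_forall_pos {n : ℕ} (P : ArithCircuit k (Fin n)) (t : ℕ)
    (h2 : P.IsFanInTwo) (hs : P.size ≤ n + t) (hpos : ∀ j : Fin n, 0 < P.eval.degreeOf j)
    (j : Fin n) : P.eval.degreeOf j ≤ 2 ^ (t + 1) := by
  have h12 : 1 ≤ 2 ^ (t + 1) := Nat.one_le_two_pow
  revert hpos
  unfold ArithCircuit.eval
  cases P.output with
  | var y =>
    intro _
    refine (degreeOf_X_le' j y).trans ?_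
    split_ifs <;> omega
  | const c => intro _; simp [Operand.eval, degreeOf_C]
  | gate o =>
    simp only [Operand.eval]
    intro hpos
    by_cases ho : o < P.gates.length
    swap
    · rw [List.getD_eq_getElem?_getD, List.getElem?_eq_none
        (by rw [gateValues_length]; exact Nat.le_of_not_lt ho)]
      simp
    have hocc : ∀ x, 1 ≤ occ P.gates o x := by
      intro x
      by_contra hx
      have h0 : occ P.gates o x = 0 := by omega
      have := (degreeOf_gateValues_getD_le x P.gates o ho).trans_eq
        (Lf_eq_zero_of_occ_eq_zero h0)
      exact absurd (hpos x) (by omega)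
    exact degreeOf_getD_le_two_pow_of_forall_occ P.gates t h2 ho hs hocc j

end Main

end LinearSize

open Literature.Computability.AlgebraicComplexity ArithCircuit MvPolynomial LinearSize in
/-- **Registered sub-goal `exists_degreeOf_le_two_of_complexity_le`** (crux
stmt-ValiantsHypothesis-8745, line `registered`, lead c3): a polynomial of fan-in-two complexity
`≤ n` in `n ≥ 1` variables has a variable of individual degree `≤ 2` — the structure theorem
behind the first rung (`b ≤ 1`) of `BarrierLever.DefinableEquations`. [folklore] -/
theorem exists_degreeOf_le_two_of_complexity_le :
    ∀ n : ℕ, 1 ≤ n → ∀ f : MvPolynomial (Fin n) ℂ,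
      Literature.Computability.AlgebraicComplexity.complexity f ≤ n → ∃ j : Fin n, f.degreeOf j ≤ 2 := by
  intro n hn f hf
  obtain ⟨P, h2, hPf, hs⟩ := exists_computes_size_eq_complexity f
  rw [← show P.eval = f from hPf]
  exact exists_degreeOf_le_two_of_size_le hn P h2 (hs ▸ hf)

open Literature.Computability.AlgebraicComplexity ArithCircuit MvPolynomial LinearSize in
/-- **All-variables form**: if `L(f) ≤ n` and every one of the `n` variables has positive degree
in `f`, then every variable has individual degree `≤ 2` in `f`. [folklore] -/
theorem degreeOf_le_two_of_complexity_le_of_forall_pos {n : ℕ} (f : MvPolynomial (Fin n) ℂ)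
    (hf : Literature.Computability.AlgebraicComplexity.complexity f ≤ n)
    (hpos : ∀ j : Fin n, 0 < f.degreeOf j) (j : Fin n) : f.degreeOf j ≤ 2 := by
  obtain ⟨P, h2, hPf, hs⟩ := exists_computes_size_eq_complexity f
  have hPf' : P.eval = f := hPf
  subst hPf'
  simpa using degreeOf_le_two_pow_of_size_le_of_forall_pos P 0 h2 (by simpa using hs ▸ hf) hpos j

open Literature.Computability.AlgebraicComplexity ArithCircuit MvPolynomial LinearSize in
/-- **Excess form**: if `L(f) ≤ n + t` (`n ≥ 1`) then some variable has individual degree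
`≤ 2^(t+1)` in `f`. [folklore] -/
theorem exists_degreeOf_le_two_pow_of_complexity_le {n : ℕ} (hn : 1 ≤ n) (t : ℕ)
    (f : MvPolynomial (Fin n) ℂ)
    (hf : Literature.Computability.AlgebraicComplexity.complexity f ≤ n + t) :
    ∃ j : Fin n, f.degreeOf j ≤ 2 ^ (t + 1) := by
  obtain ⟨P, h2, hPf, hs⟩ := exists_computes_size_eq_complexity f
  rw [← show P.eval = f from hPf]
  exact exists_degreeOf_le_two_pow_of_size_le hn P t h2 (hs ▸ hf)

open Literature.Computability.AlgebraicComplexity ArithCircuit MvPolynomial LinearSize in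
/-- **A circuit lower bound from individual degrees**: if every one of the `n ≥ 1` variables has
individual degree `> 2^(t+1)` in `f`, then `L(f) > n + t` — the variable count `n - 1` and the
degree bound `log₂ deg` add up. E.g. `L((x₁⋯x_n)^(2^(t+1)+1)) ≥ n + t + 1`. [folklore] -/
theorem add_lt_complexity_of_forall_two_pow_lt_degreeOf {n : ℕ} (hn : 1 ≤ n) (t : ℕ)
    (f : MvPolynomial (Fin n) ℂ) (hdeg : ∀ j : Fin n, 2 ^ (t + 1) < f.degreeOf j) :
    n + t < Literature.Computability.AlgebraicComplexity.complexity f := by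
  by_contra h
  obtain ⟨j, hj⟩ := exists_degreeOf_le_two_pow_of_complexity_le hn t f (Nat.le_of_not_lt h)
  exact absurd (hdeg j) (Nat.not_lt.2 hj)

end Summit.ValiantsHypothesis.ValiantsHypothesis.Theorems.BarrierLeverDefinableEquations

end
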